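import Summits.QuantumFields.BalabanUV.Beta.GAN24.HardMinimiserTowerCubic

/-!
# G-an2-4 ∕ (CONV-C), road P2 — THE HARD SCALAR MINIMISER `H_n = G′Q′*(Q′G′Q′*)⁻¹` AT `U = 1` IN COLUMN CURRENCY: the one-leg-averaged increment
# `Qf·H_{L·n_k} − H_{n_k}` (route C-R6°'s Ξ-row object `Qf·ℋ′ − ℋ`) along the `lev` tower on cubic unit tori, UNCONDITIONALLY — its block means VANISH
# identically, it obeys the tower letter `C(1+log L)(k+1)L^{−k}e^{−δ|blk x − y|}`, and `k ↦ H_{n_k}` carries the row's two-clause shape with the comparison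
# map `Qf` (both clauses read at level `k`); plus the soft companion identity `Q′·(Qf·M′ − M) = S′ − S`

G-an2-4 formalisation swarm `b2b-balaban-gan24-formalise-*`, leaf prover 06 (gen 61), crux team (2) under the coordinator ruling «YM REDIRECT»
(e34b3e0c; FREEZE (0) honoured — a `GAN24/` corollary importing EXISTING modules only; no Support leaf, no `def`, no cite, no sorry).

WHY THIS FILE.  Route C-R6° (road P3, PARTs 105–114) tabulates the two (CONV-C)-shape clauses of the three blocks `[[𝒢, ℋ],[ℋᵀ, −𝒮]]` of the bordered
inverse; its Ξ-row RATE entry is PART 113 `BlockRatesFromSoftResolvent.abs_avg_minOp_sub_le_of_soft`, whose CONCLUSION is a letter on the one-leg-averaged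
hard-minimiser increment `Qf·ℋ′ − ℋ` (fine × unit; it is also PART 114 §2's `A₁`-hypothesis), derived there from ONE entrywise letter on the soft resolvent's
sandwiched increment `E`.  Engines E-leaf02-g77-1 ∕ -2 and E-leaf06-g61-1 (GAPS §§ E-gan24leaf02-g77-1, E-gan24leaf06-g61-1) priced those shapes on road P2's
`U = 1` scalar prototype: the entrywise `E`-letter is NOT k-uniformly instantiable in any dimension ≥ 2, while every COLUMN object (fine × unit, one leg averaged
with row mass 1) carries a geometric letter.  leaf-02 g77's `SoftMinimiserTowerCubic` §4 typed the column-row object `Qf·M′ − M` (`= a′·E·Qᵀ`).  THIS FILE types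
the Ξ-row object at `U = 1` — the HARD column `Qf·H_{L·n_k} − H_{n_k}` with `H_n = Mhard n T a′` (gan24-p2 g29's `HardMinimiserOneStepSup.Mhard`), `Qf = Qavg0 (lev L k) L`
— from this lineage's tower law `HardMinimiserTowerCubic.norm_Mhard_tower_step_le_cubic` (prolongation currency `H′ − J·H`) through leaf-02's two transfer lemmas
`Qavg0_mul_sub_eq` (`Qf·A′ − A = Qf·(A′ − J·A)`, since `Qf·J = 1`) and `norm_Qavg0_mul_apply_le` (row mass 1) BY NAME; so PART 113's Ξ-conclusion holds on the
prototype UNCONDITIONALLY although 113's hypothesis has no instance there.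
 * §1 (any torus `M : Fin d → ℕ`, any `N, R`) **`QsOp_mul_Qavg0_Mhard_sub`**: `Q′_N·(Qf·H_{RN} − H_N) = 0` — the hard column increment is a PURE FLUCTUATION
   (zero block means: `Q′_N·Qf = Q′_{RN}`, `GaugeTermScalarData.QsOp_mul_Qavg0`, and `Q′_n·H_n = 1`, `HardMinimiserOneStepSup.QsOp_mul_Mhard`);
   **`QsOp_mul_Qavg0_Msoft_sub`**: `Q′_N·(Qf·M_{RN} − M_N) = S_{RN} − S_N` — the soft column increment's block means ARE the P-block increment of leaf-06 g36's
   `ScalarUnitLatticeTower` (`Savg n = Q′_n·M_n` by definition).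
 * §2 (cubic tori, the `lev` tower) **`norm_Qavg0_Mhard_succ_sub_le_lev`** — `‖(Qf·H_{L·n_k} − H_{n_k})(x, y)‖ ≤ C·(1 + log L)·(k+1)·L^{−k}·e^{−δ|blockOf x − y|_{T,∞}}`
   for every `L, N₀ ≥ 1`, `k`, level-`k` fine `x`, unit `y`, ONE pair `(C, δ)` (functions of `d, a′`).
 * §3 **`convC_shape_Mhard_column_cubic`** — the row's TWO CLAUSES for `k ↦ H_{n_k}` IN COLUMN CURRENCY, both read at level `k`: (1) `‖H_{n_k}(x,y)‖ ≤ C₇e^{−δ₇|…|}`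
   (k-uniform decay, this lineage's `norm_Mhard_apply_le`), (2) `‖(Qf·H_{L·n_k} − H_{n_k})(x,y)‖ ≤ C₇(1∕√L)^k e^{−δ₇|…|}` (geometric one-step rate through the
   comparison map `Qf`), ONE pair `(C₇, δ₇)` (`δ₇(d,a′)`, `C₇(d,a′,L)` before `N₀, k`; `geometric_scale` BY NAME).
HONEST SCOPE.  [folklore] corollaries of tree theorems BY NAME (two matrix identities, one `obtain` per input, one row-mass-1 transfer, real arithmetic; no new
estimate); scalar (0-form) `U = 1` PROTOTYPE on CUBIC unit tori `fun _ : Fin (d+1) ⇒ N₀` (§2–§3), the unit torus FIXED along the tower; constants ∕ rates EXISTENTIAL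
in size; `θ = L^{−1∕2}` absorbs `(k+1)` (the engines see `L⁻²` for the column increments themselves — the typed law is not sharp in the exponent, and need not be).
§2 IS route C-R6°'s Ξ-row conclusion shape at `U = 1` up to road P3's normalisation dictionary (`ℋ = minOp H Q ↔ Mhard`, `Qf ↔ Qavg0`; stated here in prose, not
typed); the SHAPE of `DirichletExhaustion.ConvC` for a fine × unit kernel with a comparison map, NOT an instance of that predicate; NOT (CONV-C) as typed (Bałaban's
`(G_k, H_k, C^{(k)})` at general `U`), NEVER «G-an2-4 closed», NOT NE2 ∕ NE3, NOT D1, NOT BetaPertH, NOT continuum, NOT Clay; 0 def, 0 `def … : Prop`, 0 cite,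
0 sorry — not in print, our bookkeeping.
HONEST DEPENDENCY: continuum YM on T⁴ ⇐ BetaPertH ∧ nine spine estimates (0/9 proved); BetaPertH ⇐ (D1) ∧ (D4) ∧ CAP+tail; G-an2-4 gates asym, D1 and NE2/3/4.
-/

noncomputable section

open scoped BigOperators ComplexConjugate Matrix

namespace Summit.QuantumFields.BalabanUV.Beta.GAN24.HardMinimiserColumnCubic

open Literature.MathematicalPhysics.QuantumFieldTheory.Balaban1983to89
open B5Prop11Plancherel (Tor fine)
open B5Block118 (QsOp)
open B5Blocks16 (blockOf)
open B6LowerBound2153Torus (rep)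
open B4TorusKernel.MultiPeriod (torusSupNorm)
open B5G183RateUnitTower (lev)
open Summit.QuantumFields.BalabanUV.T4Continuum.ScalarBlockPlanting (Qavg0)
open Summit.QuantumFields.BalabanUV.T4Continuum.ScalarPlantingDefect (blockOf_par)
open Summit.QuantumFields.BalabanUV.T4Continuum.GaugeTermScalarData (QsOp_mul_Qavg0)
open Summit.QuantumFields.BalabanUV.Beta.GAN24.SoftMinimiserOneStepSup (Msoft)
open Summit.QuantumFields.BalabanUV.Beta.GAN24.HardMinimiserOneStepSup (Savg Mhard QsOp_mul_Mhard)
open Summit.QuantumFields.BalabanUV.Beta.GAN24.HardMinimiserTowerCubic (norm_Mhard_apply_le norm_Mhard_tower_step_le_cubic geometric_scale)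
open Summit.QuantumFields.BalabanUV.T4Continuum.ScalarBlockPlanting (Qavg0_mul_apply Qavg0_mul_conjTranspose)
open Summit.QuantumFields.BalabanUV.T4Continuum.BalabanAveragedTowerModes (par par_cpt_add_off)
open B5G183RateTorus (cpt)
open B5G183RateTorusW (off)
open Summit.QuantumFields.BalabanUV.Beta.GAN24.StaircaseLaplacianDefect (stair stair_eq_smul_Qavg0H)

/-! ## §1 Block means of the column increments: the hard one is a pure fluctuation, the soft one is the P-block increment (any torus) -/

section BlockMeans

variable {d : ℕ} (N R : ℕ) [NeZero N] [NeZero R] (M : Fin d → ℕ) [∀ μ, NeZero (M μ)]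

/-- [folklore] **THE HARD COLUMN INCREMENT HAS ZERO BLOCK MEANS**: `Q′_N·(Qf·H_{RN} − H_N) = 0` for the hard minimiser `H_n = Mhard n M a′` (`a′ > 0`),
`Qf = Qavg0 N R M` — because `Q′_N·Qf = Q′_{RN}` (averaging block averages is averaging; `GaugeTermScalarData.QsOp_mul_Qavg0`) and `Q′_n·H_n = 1` at both levels
(`HardMinimiserOneStepSup.QsOp_mul_Mhard`).  The Ξ-row object of route C-R6° is a pure fluctuation column. -/
theorem QsOp_mul_Qavg0_Mhard_sub {a' : ℝ} (ha' : 0 < a') :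
    QsOp N M * (Qavg0 N R M * Mhard (R * N) M a' - Mhard N M a') = 0 := by
  rw [Matrix.mul_sub, ← Matrix.mul_assoc, QsOp_mul_Qavg0 M N R, QsOp_mul_Mhard (R * N) M ha', QsOp_mul_Mhard N M ha', sub_self]

/-- [folklore] **THE SOFT COLUMN INCREMENT's BLOCK MEANS ARE THE P-BLOCK INCREMENT**: `Q′_N·(Qf·M_{RN} − M_N) = S_{RN} − S_N` for the soft minimiser
`M_n = Msoft n M a′` and `S_n = Savg n M a′ = Q′_n·M_n` (`HardMinimiserOneStepSup.Savg`, by definition) — leaf-02 g77's column object (`SoftMinimiserTowerCubic` §4)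
averages to leaf-06 g36's unit-lattice tower object (`ScalarUnitLatticeTower`). -/
theorem QsOp_mul_Qavg0_Msoft_sub (a' : ℝ) :
    QsOp N M * (Qavg0 N R M * Msoft (R * N) M a' - Msoft N M a') = Savg (R * N) M a' - Savg N M a' := by
  rw [Matrix.mul_sub, ← Matrix.mul_assoc, QsOp_mul_Qavg0 M N R]
  rfl

end BlockMeans

/-! ## §2 The hard column letter along the `lev` tower on cubic unit tori -/

variable (d : ℕ)

/-- **THE HARD COLUMN LETTER OF ROUTE C-R6°'s Ξ-ROW AT `U = 1`, ALONG THE TOWER, UNCONDITIONAL**: `∃ C δ > 0` (functions of `d, a′`) with, for every `L ≥ 1`,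
`N₀ ≥ 1`, `k`, every level-`k` fine site `x` and unit site `y`,
`‖(Qf·H_{L·n_k} − H_{n_k})(x, y)‖ ≤ C·(1 + log L)·(k+1)·L^{−k}·e^{−δ·|blockOf x − y|_{T,∞}}` (`Qf = Qavg0 (lev L k) L`, `H_n = Mhard n T a′`, `n_k = lev L k`, `lev L (k+1) = L·lev L k`
by `rfl`) — this lineage's `HardMinimiserTowerCubic.norm_Mhard_tower_step_le_cubic` (prolongation currency `H′ − J·H`, weight at `blockOf x′`) through the two transfer steps of leaf-02 g77's
`SoftMinimiserTowerCubic` §4 (`Qf·H′ − H = Qf·(H′ − J·H)` since `Qf·J = 1`; row mass 1), re-proved inline here from `ScalarBlockPlanting.Qavg0_mul_apply` ∕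
`Qavg0_mul_conjTranspose`, `StaircaseLaplacianDefect.stair_eq_smul_Qavg0H`, `par_cpt_add_off`, the weight moved by `ScalarPlantingDefect.blockOf_par`. [folklore] -/
theorem norm_Qavg0_Mhard_succ_sub_le_lev {a' : ℝ} (ha' : 0 < a') :
    ∃ C δ : ℝ, 0 < C ∧ 0 < δ ∧ ∀ (L N₀ : ℕ) [NeZero L] [NeZero N₀] (k : ℕ)
      (x : Tor (fine (lev L k) (fun _ : Fin (d + 1) => N₀))) (y : Tor (fun _ : Fin (d + 1) => N₀)),
        ‖(Qavg0 (lev L k) L (fun _ : Fin (d + 1) => N₀) * Mhard (L * lev L k) (fun _ : Fin (d + 1) => N₀) a'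
            - Mhard (lev L k) (fun _ : Fin (d + 1) => N₀) a') x y‖
          ≤ C * (1 + Real.log (L : ℝ)) * ((k : ℝ) + 1) / (L : ℝ) ^ k
              * Real.exp (-(δ * torusSupNorm (fun _ : Fin (d + 1) => N₀)
                  (rep (fun _ : Fin (d + 1) => N₀) (blockOf (lev L k) (fun _ : Fin (d + 1) => N₀) x)
                    - rep (fun _ : Fin (d + 1) => N₀) y))) := by
  obtain ⟨C, δ, hC, hδ, h⟩ := norm_Mhard_tower_step_le_cubic d ha'
  refine ⟨C, δ, hC, hδ, fun L N₀ _ _ k x y => ?_⟩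
  -- `Qf·H′ − H = Qf·(H′ − J·H)` since `Qf·J = 1` (`stair = L^{d+1}•Qfᴴ`, `Qf·Qfᴴ = L^{−(d+1)}•1`)
  have hLc : ((L : ℂ) ^ (d + 1)) ≠ 0 := pow_ne_zero _ (by exact_mod_cast NeZero.ne L)
  have hQJ : Qavg0 (lev L k) L (fun _ : Fin (d + 1) => N₀) * stair (lev L k) L (fun _ : Fin (d + 1) => N₀) = 1 := by
    rw [stair_eq_smul_Qavg0H, Matrix.mul_smul, Qavg0_mul_conjTranspose, smul_smul, mul_inv_cancel₀ hLc, one_smul]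
  have e : Qavg0 (lev L k) L (fun _ : Fin (d + 1) => N₀) * Mhard (L * lev L k) (fun _ : Fin (d + 1) => N₀) a'
        - Mhard (lev L k) (fun _ : Fin (d + 1) => N₀) a'
      = Qavg0 (lev L k) L (fun _ : Fin (d + 1) => N₀) * (Mhard (L * lev L k) (fun _ : Fin (d + 1) => N₀) a'
          - stair (lev L k) L (fun _ : Fin (d + 1) => N₀) * Mhard (lev L k) (fun _ : Fin (d + 1) => N₀) a') := by
    rw [Matrix.mul_sub, ← Matrix.mul_assoc, hQJ, Matrix.one_mul]
  -- row mass 1: the `L^{d+1}` children of the block of `x` each weigh `L^{−(d+1)}`, and each carries the tower bound at weight `blockOf x`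
  set B := C * (1 + Real.log (L : ℝ)) * ((k : ℝ) + 1) / (L : ℝ) ^ k
      * Real.exp (-(δ * torusSupNorm (fun _ : Fin (d + 1) => N₀)
          (rep (fun _ : Fin (d + 1) => N₀) (blockOf (lev L k) (fun _ : Fin (d + 1) => N₀) x) - rep (fun _ : Fin (d + 1) => N₀) y))) with hB
  have hLr : ((L : ℝ) ^ (d + 1)) ≠ 0 := pow_ne_zero _ (by exact_mod_cast NeZero.ne L)
  have hnorm : ‖((L : ℂ) ^ (d + 1))⁻¹‖ = ((L : ℝ) ^ (d + 1))⁻¹ := by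
    rw [norm_inv, norm_pow, Complex.norm_natCast]
  have hchild : ∀ j : Fin (d + 1) → Fin L,
      ‖(Mhard (L * lev L k) (fun _ : Fin (d + 1) => N₀) a'
          - stair (lev L k) L (fun _ : Fin (d + 1) => N₀) * Mhard (lev L k) (fun _ : Fin (d + 1) => N₀) a')
        (cpt (lev L k) L (fun _ : Fin (d + 1) => N₀) x + off (lev L k) L (fun _ : Fin (d + 1) => N₀) j) y‖ ≤ B := fun j => by
    have h1 := h L N₀ k (cpt (lev L k) L (fun _ : Fin (d + 1) => N₀) x + off (lev L k) L (fun _ : Fin (d + 1) => N₀) j) y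
    rwa [← blockOf_par (lev L k) L (fun _ : Fin (d + 1) => N₀), par_cpt_add_off] at h1
  rw [e, Qavg0_mul_apply, norm_mul, hnorm]
  calc ((L : ℝ) ^ (d + 1))⁻¹ * ‖∑ j : Fin (d + 1) → Fin L, (Mhard (L * lev L k) (fun _ : Fin (d + 1) => N₀) a'
            - stair (lev L k) L (fun _ : Fin (d + 1) => N₀) * Mhard (lev L k) (fun _ : Fin (d + 1) => N₀) a')
            (cpt (lev L k) L (fun _ : Fin (d + 1) => N₀) x + off (lev L k) L (fun _ : Fin (d + 1) => N₀) j) y‖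
      ≤ ((L : ℝ) ^ (d + 1))⁻¹ * ∑ _j : Fin (d + 1) → Fin L, B :=
        mul_le_mul_of_nonneg_left ((norm_sum_le _ _).trans (Finset.sum_le_sum fun j _ => hchild j)) (by positivity)
    _ = B := by
        simp only [Finset.sum_const, Finset.card_univ, Fintype.card_fun, Fintype.card_fin, nsmul_eq_mul]
        push_cast
        field_simp

/-! ## §3 The two clauses for the hard minimiser in column currency, both read at level `k` -/

/-- **THE (CONV-C) TWO-CLAUSE SHAPE FOR THE HARD SCALAR MINIMISER IN COLUMN CURRENCY, UNCONDITIONAL.**  There is a rate `δ₇ > 0` (a function of `d, a′`)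
such that for every `L ≥ 2` there is `C₇ > 0` (a function of `d, a′, L`) with, for every `N₀ ≥ 1`, every level `k`, every level-`k` fine site `x` and unit site `y`
(cubic unit torus `Π_μ ℤ/N₀`, dimension `d+1`; `n_k = lev L k`, `H_n = Mhard n T a′`, `Qf = Qavg0 (lev L k) L`):
(1) `‖H_{n_k}(x, y)‖ ≤ C₇·e^{−δ₇|blockOf x − y|_{T,∞}}` (k-UNIFORM DECAY — this lineage's `norm_Mhard_apply_le`), and
(2) `‖(Qf·H_{L·n_k} − H_{n_k})(x, y)‖ ≤ C₇·(1∕√L)^k·e^{−δ₇|blockOf x − y|_{T,∞}}` (GEOMETRIC ONE-STEP RATE through the comparison map, `θ = L^{−1∕2}`; §2 and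
`HardMinimiserTowerCubic.geometric_scale`), ONE pair `(C₇, δ₇)`.  The column twin of `HardMinimiserTowerCubic.convC_shape_Mhard_tower_cubic` (there clause 2 is read
in prolongation currency at level `k+1`). [folklore] -/
theorem convC_shape_Mhard_column_cubic {a' : ℝ} (ha' : 0 < a') :
    ∃ δ₇ : ℝ, 0 < δ₇ ∧ ∀ (L : ℕ) [NeZero L], 2 ≤ L → ∃ C₇ : ℝ, 0 < C₇ ∧ ∀ (N₀ : ℕ) [NeZero N₀] (k : ℕ)
      (x : Tor (fine (lev L k) (fun _ : Fin (d + 1) => N₀))) (y : Tor (fun _ : Fin (d + 1) => N₀)),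
      ‖Mhard (lev L k) (fun _ : Fin (d + 1) => N₀) a' x y‖
          ≤ C₇ * Real.exp (-(δ₇ * torusSupNorm (fun _ : Fin (d + 1) => N₀)
              (rep (fun _ : Fin (d + 1) => N₀) (blockOf (lev L k) (fun _ : Fin (d + 1) => N₀) x) - rep (fun _ : Fin (d + 1) => N₀) y))) ∧
      ‖(Qavg0 (lev L k) L (fun _ : Fin (d + 1) => N₀) * Mhard (L * lev L k) (fun _ : Fin (d + 1) => N₀) a'
            - Mhard (lev L k) (fun _ : Fin (d + 1) => N₀) a') x y‖
          ≤ C₇ * ((Real.sqrt L)⁻¹) ^ k * Real.exp (-(δ₇ * torusSupNorm (fun _ : Fin (d + 1) => N₀)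
              (rep (fun _ : Fin (d + 1) => N₀) (blockOf (lev L k) (fun _ : Fin (d + 1) => N₀) x) - rep (fun _ : Fin (d + 1) => N₀) y))) := by
  obtain ⟨C, δ, hC, hδ, h⟩ := norm_Qavg0_Mhard_succ_sub_le_lev d ha'
  obtain ⟨CH, δH, hCH, hδH, hH⟩ := norm_Mhard_apply_le d ha'
  refine ⟨min δ δH, lt_min hδ hδH, fun L _ hL2 => ?_⟩
  have hL1 : (1 : ℝ) < L := by exact_mod_cast hL2
  obtain ⟨hy0, hy1, -⟩ := geometric_scale hL1 hC.le 0
  set θ : ℝ := (Real.sqrt L)⁻¹ with hθ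
  set C₇ := max CH (C * (1 + Real.log L) / (1 - θ))
  have hC₇pos : 0 < C₇ := lt_max_of_lt_left hCH
  refine ⟨C₇, hC₇pos, fun N₀ _ k x y₂ => ?_⟩
  set t := torusSupNorm (fun _ : Fin (d + 1) => N₀)
    (rep (fun _ : Fin (d + 1) => N₀) (blockOf (lev L k) (fun _ : Fin (d + 1) => N₀) x) - rep (fun _ : Fin (d + 1) => N₀) y₂)
  have ht : 0 ≤ t :=
    B4TorusKernel.MultiPeriod.torusSupNorm_nonneg (fun _ => Nat.one_le_iff_ne_zero.mpr (NeZero.ne N₀)) _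
  refine ⟨?_, ?_⟩
  · -- clause 1: k-uniform decay, rate lowered to `δ₇ ≤ δ_H`
    have h1 := hH (lev L k) (fun _ : Fin (d + 1) => N₀) x y₂
    have hE : Real.exp (-(δH * t)) ≤ Real.exp (-(min δ δH * t)) :=
      Real.exp_le_exp.mpr (by nlinarith [min_le_right δ δH])
    exact h1.trans (mul_le_mul (le_max_left _ _) hE (Real.exp_pos _).le hC₇pos.le)
  · -- clause 2: the column letter (§2), with `(k+1)·L^{−k} ≤ θ^k∕(1 − θ)` absorbed into `C₇`
    have h2 := h L N₀ k x y₂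
    have hE : Real.exp (-(δ * t)) ≤ Real.exp (-(min δ δH * t)) :=
      Real.exp_le_exp.mpr (by nlinarith [min_le_left δ δH])
    have hθk : 0 ≤ θ ^ k := pow_nonneg hy0.le k
    have hcoef : C * (1 + Real.log (L : ℝ)) * ((k : ℝ) + 1) / (L : ℝ) ^ k ≤ C₇ * θ ^ k :=
      (geometric_scale hL1 hC.le k).2.2.trans (mul_le_mul_of_nonneg_right (le_max_right _ _) hθk)
    exact h2.trans (mul_le_mul hcoef hE (Real.exp_pos _).le (mul_nonneg hC₇pos.le hθk))

end Summit.QuantumFields.BalabanUV.Beta.GAN24.HardMinimiserColumnCubic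

end
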